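import Summits.ResolutionOfSingularities.ResolutionOfSingularities.Theses.FrobeniusLadder
import Summits.ResolutionOfSingularities.ResolutionOfSingularities.Theorems.FrobeniusLadderFRationalModificationIntegralForm
import Literature.AlgebraicGeometry.Resolution.Blowups
import Mathlib.AlgebraicGeometry.Morphisms.Finite
import Mathlib.AlgebraicGeometry.Morphisms.Proper
import Mathlib.AlgebraicGeometry.IdealSheaf.Subscheme
import HarnessLib

/-!
# Line `cartier-crystal-centres` — lead skeleton v1L (crux `FrobeniusLadder.FRationalModification`,
stmt-ResolutionOfSingularities-15316; lead prover-line-stmt-ResolutionOfSingularities-15316-c8-0, cycle 9)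

The crux-plan seat `planner-cruxplan-…-cartier-crystal-cent-0` registered skeleton v1 of this line
(2026-08-17T07:54Z, sha 21ef9ee0, 3 stubs) but could not publish it under `Cruxes/…/Lines/` (crux write
refused for its truncated unit name) and the gate evidence store is not mounted in a lead's jail, so the
planner's FILE is unreadable here. This skeleton is the lead's reconstruction: the three engine stubs are
the planner's REGISTERED signatures verbatim (generated and asserted equal by `tools/gen_skeleton.py`),
and the tower bookkeeping between them and the crux is isolated as a fourth, lead-held stub
`stub_towerAssembly` (plumbing: blow-up existence/properness/integrality, normalisation, composition of
proper birational maps, strong induction on the measure) so that the wave on the engine stubs can start at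
once; `FRationalModification_of` is sorry-free modulo the four stubs and concludes the route decl BY NAME
through the landed consumer `IntegralForm.fRationalModification_iff_integral` (p131587).

ENGINE (idea card `Ideas/cartier-crystal-centres.md`, triage r1-1/2/3 pass): start from an integral rung-2
`Y` (locally domain + Cohen–Macaulay + parameter ideals Frobenius closed); (1) `stub_isolateDefect`: a
rung-2-preserving proper birational modification after which the DEFECT (non-rung-3 = non-F-rational
locus) is finite; (2) `stub_pointStep_preserves`: the normalised blow-up of the (closure of the) finite
non-empty defect is again rung-2 with finite defect; (3) `stub_pointTower_measure`: an `ℕ`-valued measure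
drops at every such step; (4) `stub_towerAssembly`: hence finitely many steps reach an integral model with
empty defect, i.e. a rung-3 model, and proper birational maps compose.

Stubs: `stub_isolateDefect` (planner: hardest; lead holds), `stub_pointStep_preserves` (planner: attack
first; wave), `stub_pointTower_measure` (wave), `stub_towerAssembly` (lead; provable plumbing, to be
landed first and then removed from the skeleton).
-/

-- single-problem summit: the doubled namespace component `ResolutionOfSingularities` is forced
set_option linter.dupNamespace false

noncomputable section

open CategoryTheory AlgebraicGeometry TopologicalSpace IsLocalRing
open Literature.AlgebraicGeometry.Resolution
open Summit.ResolutionOfSingularities.ResolutionOfSingularities.Theses.FrobeniusLadder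
open Summit.ResolutionOfSingularities.ResolutionOfSingularities.Theorems.FRationalModification

namespace Summit.ResolutionOfSingularities.ResolutionOfSingularities.Cruxes.FRationalModification.Lines.CartierCrystalCentres

/-! ## The engine stubs (planner-registered signatures, verbatim) -/

/-- STUB `stub_isolateDefect` (OPEN; planner: hardest; held by the lead). Every integral separated
finite-type rung-2 `Y/k` has a proper birational INTEGRAL rung-2 model `W → Y` whose defect
(the set of points whose local ring fails the rung-3 = F-rational clause) is finite. -/
theorem stub_isolateDefect
    (p : ℕ) [Fact p.Prime] (k : Type) [Field k] [CharP k p] (Y : Scheme.{0}) (g : Y ⟶ Spec (.of k))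
    [IsSeparated g] [LocallyOfFiniteType g] [QuasiCompact g] [IsIntegral Y] (h₂ : ∀ y : Y, IsDomain
    (Y.presheaf.stalk y) ∧ ∀ d : ℕ, ringKrullDim (Y.presheaf.stalk y) = d → ∀ s : Fin d →
    Y.presheaf.stalk y, (Ideal.span (Set.range s)).radical.IsMaximal →
    RingTheory.Sequence.IsWeaklyRegular (Y.presheaf.stalk y) (List.ofFn s) ∧ ∀ w : Y.presheaf.stalk
    y, (∃ e : ℕ, w ^ p ^ e ∈ Ideal.span ((fun z : Y.presheaf.stalk y => z ^ p ^ e) '' (Ideal.span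
    (Set.range s) : Set (Y.presheaf.stalk y)))) → w ∈ Ideal.span (Set.range s)) : ∃ (W : Scheme.{0})
    (π : W ⟶ Y), IsProper π ∧ IsBirational π ∧ IsIntegral W ∧ (∀ w : W, IsDomain (W.presheaf.stalk
    w) ∧ ∀ d : ℕ, ringKrullDim (W.presheaf.stalk w) = d → ∀ s : Fin d → W.presheaf.stalk w,
    (Ideal.span (Set.range s)).radical.IsMaximal → RingTheory.Sequence.IsWeaklyRegular
    (W.presheaf.stalk w) (List.ofFn s) ∧ ∀ y : W.presheaf.stalk w, (∃ e : ℕ, y ^ p ^ e ∈ Ideal.span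
    ((fun z : W.presheaf.stalk w => z ^ p ^ e) '' (Ideal.span (Set.range s) : Set (W.presheaf.stalk
    w)))) → y ∈ Ideal.span (Set.range s)) ∧ {w : W | ¬ (IsDomain (W.presheaf.stalk w) ∧ ∀ d : ℕ,
    ringKrullDim (W.presheaf.stalk w) = d → ∀ s : Fin d → W.presheaf.stalk w, (Ideal.span (Set.range
    s)).radical.IsMaximal → ∀ y c : W.presheaf.stalk w, c ≠ 0 → (∀ e : ℕ, c * y ^ p ^ e ∈ Ideal.span
    ((fun z : W.presheaf.stalk w => z ^ p ^ e) '' (Ideal.span (Set.range s) : Set (W.presheaf.stalk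
    w)))) → y ∈ Ideal.span (Set.range s))}.Finite := by
  sorry

/-- STUB `stub_pointStep_preserves` (OPEN; planner: attack first; wave). For an integral separated
finite-type rung-2 `W/k` with finite non-empty defect, every blow-up `W₁ → W` of the vanishing ideal of
the closure of the defect followed by a finite birational `W₂ → W₁` from an integral scheme with
integrally closed stalks (the normalisation) yields a rung-2 `W₂` with finite defect. -/
theorem stub_pointStep_preserves
    (p : ℕ) [Fact p.Prime] (k : Type) [Field k] [CharP k p] (W : Scheme.{0}) (g : W ⟶ Spec (.of k))
    [IsSeparated g] [LocallyOfFiniteType g] [QuasiCompact g] [IsIntegral W] (h₂ : ∀ w : W, IsDomain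
    (W.presheaf.stalk w) ∧ ∀ d : ℕ, ringKrullDim (W.presheaf.stalk w) = d → ∀ s : Fin d →
    W.presheaf.stalk w, (Ideal.span (Set.range s)).radical.IsMaximal →
    RingTheory.Sequence.IsWeaklyRegular (W.presheaf.stalk w) (List.ofFn s) ∧ ∀ y : W.presheaf.stalk
    w, (∃ e : ℕ, y ^ p ^ e ∈ Ideal.span ((fun z : W.presheaf.stalk w => z ^ p ^ e) '' (Ideal.span
    (Set.range s) : Set (W.presheaf.stalk w)))) → y ∈ Ideal.span (Set.range s)) (hfin : {w : W | ¬
    (IsDomain (W.presheaf.stalk w) ∧ ∀ d : ℕ, ringKrullDim (W.presheaf.stalk w) = d → ∀ s : Fin d →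
    W.presheaf.stalk w, (Ideal.span (Set.range s)).radical.IsMaximal → ∀ y c : W.presheaf.stalk w, c
    ≠ 0 → (∀ e : ℕ, c * y ^ p ^ e ∈ Ideal.span ((fun z : W.presheaf.stalk w => z ^ p ^ e) ''
    (Ideal.span (Set.range s) : Set (W.presheaf.stalk w)))) → y ∈ Ideal.span (Set.range s))}.Finite)
    (hne : {w : W | ¬ (IsDomain (W.presheaf.stalk w) ∧ ∀ d : ℕ, ringKrullDim (W.presheaf.stalk w) =
    d → ∀ s : Fin d → W.presheaf.stalk w, (Ideal.span (Set.range s)).radical.IsMaximal → ∀ y c :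
    W.presheaf.stalk w, c ≠ 0 → (∀ e : ℕ, c * y ^ p ^ e ∈ Ideal.span ((fun z : W.presheaf.stalk w =>
    z ^ p ^ e) '' (Ideal.span (Set.range s) : Set (W.presheaf.stalk w)))) → y ∈ Ideal.span
    (Set.range s))}.Nonempty) (W₁ : Scheme.{0}) (β : W₁ ⟶ W) (hβ : IsBlowup β
    (Scheme.IdealSheafData.vanishingIdeal (⟨closure {w : W | ¬ (IsDomain (W.presheaf.stalk w) ∧ ∀ d
    : ℕ, ringKrullDim (W.presheaf.stalk w) = d → ∀ s : Fin d → W.presheaf.stalk w, (Ideal.span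
    (Set.range s)).radical.IsMaximal → ∀ y c : W.presheaf.stalk w, c ≠ 0 → (∀ e : ℕ, c * y ^ p ^ e ∈
    Ideal.span ((fun z : W.presheaf.stalk w => z ^ p ^ e) '' (Ideal.span (Set.range s) : Set
    (W.presheaf.stalk w)))) → y ∈ Ideal.span (Set.range s))}, isClosed_closure⟩ : Closeds W))) (W₂ :
    Scheme.{0}) (ν : W₂ ⟶ W₁) [IsIntegral W₂] (hN : ∀ x : W₂, IsIntegrallyClosed (W₂.presheaf.stalk
    x)) [IsFinite ν] (hν : IsBirational ν) : (∀ x : W₂, IsDomain (W₂.presheaf.stalk x) ∧ ∀ d : ℕ,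
    ringKrullDim (W₂.presheaf.stalk x) = d → ∀ s : Fin d → W₂.presheaf.stalk x, (Ideal.span
    (Set.range s)).radical.IsMaximal → RingTheory.Sequence.IsWeaklyRegular (W₂.presheaf.stalk x)
    (List.ofFn s) ∧ ∀ y : W₂.presheaf.stalk x, (∃ e : ℕ, y ^ p ^ e ∈ Ideal.span ((fun z :
    W₂.presheaf.stalk x => z ^ p ^ e) '' (Ideal.span (Set.range s) : Set (W₂.presheaf.stalk x)))) →
    y ∈ Ideal.span (Set.range s)) ∧ {x : W₂ | ¬ (IsDomain (W₂.presheaf.stalk x) ∧ ∀ d : ℕ,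
    ringKrullDim (W₂.presheaf.stalk x) = d → ∀ s : Fin d → W₂.presheaf.stalk x, (Ideal.span
    (Set.range s)).radical.IsMaximal → ∀ y c : W₂.presheaf.stalk x, c ≠ 0 → (∀ e : ℕ, c * y ^ p ^ e
    ∈ Ideal.span ((fun z : W₂.presheaf.stalk x => z ^ p ^ e) '' (Ideal.span (Set.range s) : Set
    (W₂.presheaf.stalk x)))) → y ∈ Ideal.span (Set.range s))}.Finite := by
  sorry

/-- STUB `stub_pointTower_measure` (OPEN; wave). There is an `ℕ`-valued measure on schemes that drops
strictly at every normalised blow-up of the finite non-empty defect of an integral separated finite-type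
rung-2 `W/k` whose result is again rung-2 with finite defect (termination of the point tower). -/
theorem stub_pointTower_measure
    (p : ℕ) [Fact p.Prime] (k : Type) [Field k] [CharP k p] : ∃ μ : Scheme.{0} → ℕ, ∀ (W :
    Scheme.{0}) (g : W ⟶ Spec (.of k)) [IsSeparated g] [LocallyOfFiniteType g] [QuasiCompact g]
    [IsIntegral W], (∀ w : W, IsDomain (W.presheaf.stalk w) ∧ ∀ d : ℕ, ringKrullDim
    (W.presheaf.stalk w) = d → ∀ s : Fin d → W.presheaf.stalk w, (Ideal.span (Set.range
    s)).radical.IsMaximal → RingTheory.Sequence.IsWeaklyRegular (W.presheaf.stalk w) (List.ofFn s) ∧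
    ∀ y : W.presheaf.stalk w, (∃ e : ℕ, y ^ p ^ e ∈ Ideal.span ((fun z : W.presheaf.stalk w => z ^ p
    ^ e) '' (Ideal.span (Set.range s) : Set (W.presheaf.stalk w)))) → y ∈ Ideal.span (Set.range s))
    → {w : W | ¬ (IsDomain (W.presheaf.stalk w) ∧ ∀ d : ℕ, ringKrullDim (W.presheaf.stalk w) = d → ∀
    s : Fin d → W.presheaf.stalk w, (Ideal.span (Set.range s)).radical.IsMaximal → ∀ y c :
    W.presheaf.stalk w, c ≠ 0 → (∀ e : ℕ, c * y ^ p ^ e ∈ Ideal.span ((fun z : W.presheaf.stalk w =>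
    z ^ p ^ e) '' (Ideal.span (Set.range s) : Set (W.presheaf.stalk w)))) → y ∈ Ideal.span
    (Set.range s))}.Finite → {w : W | ¬ (IsDomain (W.presheaf.stalk w) ∧ ∀ d : ℕ, ringKrullDim
    (W.presheaf.stalk w) = d → ∀ s : Fin d → W.presheaf.stalk w, (Ideal.span (Set.range
    s)).radical.IsMaximal → ∀ y c : W.presheaf.stalk w, c ≠ 0 → (∀ e : ℕ, c * y ^ p ^ e ∈ Ideal.span
    ((fun z : W.presheaf.stalk w => z ^ p ^ e) '' (Ideal.span (Set.range s) : Set (W.presheaf.stalk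
    w)))) → y ∈ Ideal.span (Set.range s))}.Nonempty → ∀ (W₁ : Scheme.{0}) (β : W₁ ⟶ W), IsBlowup β
    (Scheme.IdealSheafData.vanishingIdeal (⟨closure {w : W | ¬ (IsDomain (W.presheaf.stalk w) ∧ ∀ d
    : ℕ, ringKrullDim (W.presheaf.stalk w) = d → ∀ s : Fin d → W.presheaf.stalk w, (Ideal.span
    (Set.range s)).radical.IsMaximal → ∀ y c : W.presheaf.stalk w, c ≠ 0 → (∀ e : ℕ, c * y ^ p ^ e ∈
    Ideal.span ((fun z : W.presheaf.stalk w => z ^ p ^ e) '' (Ideal.span (Set.range s) : Set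
    (W.presheaf.stalk w)))) → y ∈ Ideal.span (Set.range s))}, isClosed_closure⟩ : Closeds W)) → ∀
    (W₂ : Scheme.{0}) (ν : W₂ ⟶ W₁) [IsIntegral W₂], (∀ x : W₂, IsIntegrallyClosed
    (W₂.presheaf.stalk x)) → ∀ [IsFinite ν], IsBirational ν → (∀ x : W₂, IsDomain (W₂.presheaf.stalk
    x) ∧ ∀ d : ℕ, ringKrullDim (W₂.presheaf.stalk x) = d → ∀ s : Fin d → W₂.presheaf.stalk x,
    (Ideal.span (Set.range s)).radical.IsMaximal → RingTheory.Sequence.IsWeaklyRegular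
    (W₂.presheaf.stalk x) (List.ofFn s) ∧ ∀ y : W₂.presheaf.stalk x, (∃ e : ℕ, y ^ p ^ e ∈
    Ideal.span ((fun z : W₂.presheaf.stalk x => z ^ p ^ e) '' (Ideal.span (Set.range s) : Set
    (W₂.presheaf.stalk x)))) → y ∈ Ideal.span (Set.range s)) → {x : W₂ | ¬ (IsDomain
    (W₂.presheaf.stalk x) ∧ ∀ d : ℕ, ringKrullDim (W₂.presheaf.stalk x) = d → ∀ s : Fin d →
    W₂.presheaf.stalk x, (Ideal.span (Set.range s)).radical.IsMaximal → ∀ y c : W₂.presheaf.stalk x,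
    c ≠ 0 → (∀ e : ℕ, c * y ^ p ^ e ∈ Ideal.span ((fun z : W₂.presheaf.stalk x => z ^ p ^ e) ''
    (Ideal.span (Set.range s) : Set (W₂.presheaf.stalk x)))) → y ∈ Ideal.span (Set.range s))}.Finite
    → μ W₂ < μ W := by
  sorry

/-! ## The assembly stub (lead; plumbing) -/

/-- STUB `stub_towerAssembly` (lead; provable plumbing). Granted the three engine statements at a fixed
prime `p` and field `k` — isolation of the defect, preservation under the normalised point step, and a
strictly decreasing `ℕ`-measure — every integral separated finite-type rung-2 `Y/k` has a proper
birational model all of whose stalks satisfy the rung-3 clause: isolate, then iterate the step (blow-ups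
of ideal sheaves exist and are proper and, off a nowhere-dense centre, birational with integral source;
the normalisation of an integral finite-type `k`-scheme is finite birational with integrally closed
stalks) by strong induction on the measure until the defect is empty, and compose the proper birational
maps. [folklore] -/
theorem stub_towerAssembly
    (p : ℕ) [Fact p.Prime] (k : Type) [Field k] [CharP k p] (hiso : ∀ (Y : Scheme.{0}) (g : Y ⟶ Spec
    (.of k)) [IsSeparated g] [LocallyOfFiniteType g] [QuasiCompact g] [IsIntegral Y], (∀ y : Y,
    IsDomain (Y.presheaf.stalk y) ∧ ∀ d : ℕ, ringKrullDim (Y.presheaf.stalk y) = d → ∀ s : Fin d →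
    Y.presheaf.stalk y, (Ideal.span (Set.range s)).radical.IsMaximal →
    RingTheory.Sequence.IsWeaklyRegular (Y.presheaf.stalk y) (List.ofFn s) ∧ ∀ w : Y.presheaf.stalk
    y, (∃ e : ℕ, w ^ p ^ e ∈ Ideal.span ((fun z : Y.presheaf.stalk y => z ^ p ^ e) '' (Ideal.span
    (Set.range s) : Set (Y.presheaf.stalk y)))) → w ∈ Ideal.span (Set.range s)) → ∃ (W : Scheme.{0})
    (π : W ⟶ Y), IsProper π ∧ IsBirational π ∧ IsIntegral W ∧ (∀ w : W, IsDomain (W.presheaf.stalk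
    w) ∧ ∀ d : ℕ, ringKrullDim (W.presheaf.stalk w) = d → ∀ s : Fin d → W.presheaf.stalk w,
    (Ideal.span (Set.range s)).radical.IsMaximal → RingTheory.Sequence.IsWeaklyRegular
    (W.presheaf.stalk w) (List.ofFn s) ∧ ∀ y : W.presheaf.stalk w, (∃ e : ℕ, y ^ p ^ e ∈ Ideal.span
    ((fun z : W.presheaf.stalk w => z ^ p ^ e) '' (Ideal.span (Set.range s) : Set (W.presheaf.stalk
    w)))) → y ∈ Ideal.span (Set.range s)) ∧ {w : W | ¬ (IsDomain (W.presheaf.stalk w) ∧ ∀ d : ℕ,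
    ringKrullDim (W.presheaf.stalk w) = d → ∀ s : Fin d → W.presheaf.stalk w, (Ideal.span (Set.range
    s)).radical.IsMaximal → ∀ y c : W.presheaf.stalk w, c ≠ 0 → (∀ e : ℕ, c * y ^ p ^ e ∈ Ideal.span
    ((fun z : W.presheaf.stalk w => z ^ p ^ e) '' (Ideal.span (Set.range s) : Set (W.presheaf.stalk
    w)))) → y ∈ Ideal.span (Set.range s))}.Finite) (hstep : ∀ (W : Scheme.{0}) (g : W ⟶ Spec (.of
    k)) [IsSeparated g] [LocallyOfFiniteType g] [QuasiCompact g] [IsIntegral W], (∀ w : W, IsDomain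
    (W.presheaf.stalk w) ∧ ∀ d : ℕ, ringKrullDim (W.presheaf.stalk w) = d → ∀ s : Fin d →
    W.presheaf.stalk w, (Ideal.span (Set.range s)).radical.IsMaximal →
    RingTheory.Sequence.IsWeaklyRegular (W.presheaf.stalk w) (List.ofFn s) ∧ ∀ y : W.presheaf.stalk
    w, (∃ e : ℕ, y ^ p ^ e ∈ Ideal.span ((fun z : W.presheaf.stalk w => z ^ p ^ e) '' (Ideal.span
    (Set.range s) : Set (W.presheaf.stalk w)))) → y ∈ Ideal.span (Set.range s)) → {w : W | ¬
    (IsDomain (W.presheaf.stalk w) ∧ ∀ d : ℕ, ringKrullDim (W.presheaf.stalk w) = d → ∀ s : Fin d →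
    W.presheaf.stalk w, (Ideal.span (Set.range s)).radical.IsMaximal → ∀ y c : W.presheaf.stalk w, c
    ≠ 0 → (∀ e : ℕ, c * y ^ p ^ e ∈ Ideal.span ((fun z : W.presheaf.stalk w => z ^ p ^ e) ''
    (Ideal.span (Set.range s) : Set (W.presheaf.stalk w)))) → y ∈ Ideal.span (Set.range s))}.Finite
    → {w : W | ¬ (IsDomain (W.presheaf.stalk w) ∧ ∀ d : ℕ, ringKrullDim (W.presheaf.stalk w) = d → ∀
    s : Fin d → W.presheaf.stalk w, (Ideal.span (Set.range s)).radical.IsMaximal → ∀ y c :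
    W.presheaf.stalk w, c ≠ 0 → (∀ e : ℕ, c * y ^ p ^ e ∈ Ideal.span ((fun z : W.presheaf.stalk w =>
    z ^ p ^ e) '' (Ideal.span (Set.range s) : Set (W.presheaf.stalk w)))) → y ∈ Ideal.span
    (Set.range s))}.Nonempty → ∀ (W₁ : Scheme.{0}) (β : W₁ ⟶ W), IsBlowup β
    (Scheme.IdealSheafData.vanishingIdeal (⟨closure {w : W | ¬ (IsDomain (W.presheaf.stalk w) ∧ ∀ d
    : ℕ, ringKrullDim (W.presheaf.stalk w) = d → ∀ s : Fin d → W.presheaf.stalk w, (Ideal.span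
    (Set.range s)).radical.IsMaximal → ∀ y c : W.presheaf.stalk w, c ≠ 0 → (∀ e : ℕ, c * y ^ p ^ e ∈
    Ideal.span ((fun z : W.presheaf.stalk w => z ^ p ^ e) '' (Ideal.span (Set.range s) : Set
    (W.presheaf.stalk w)))) → y ∈ Ideal.span (Set.range s))}, isClosed_closure⟩ : Closeds W)) → ∀
    (W₂ : Scheme.{0}) (ν : W₂ ⟶ W₁) [IsIntegral W₂], (∀ x : W₂, IsIntegrallyClosed
    (W₂.presheaf.stalk x)) → ∀ [IsFinite ν], IsBirational ν → (∀ x : W₂, IsDomain (W₂.presheaf.stalk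
    x) ∧ ∀ d : ℕ, ringKrullDim (W₂.presheaf.stalk x) = d → ∀ s : Fin d → W₂.presheaf.stalk x,
    (Ideal.span (Set.range s)).radical.IsMaximal → RingTheory.Sequence.IsWeaklyRegular
    (W₂.presheaf.stalk x) (List.ofFn s) ∧ ∀ y : W₂.presheaf.stalk x, (∃ e : ℕ, y ^ p ^ e ∈
    Ideal.span ((fun z : W₂.presheaf.stalk x => z ^ p ^ e) '' (Ideal.span (Set.range s) : Set
    (W₂.presheaf.stalk x)))) → y ∈ Ideal.span (Set.range s)) ∧ {x : W₂ | ¬ (IsDomain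
    (W₂.presheaf.stalk x) ∧ ∀ d : ℕ, ringKrullDim (W₂.presheaf.stalk x) = d → ∀ s : Fin d →
    W₂.presheaf.stalk x, (Ideal.span (Set.range s)).radical.IsMaximal → ∀ y c : W₂.presheaf.stalk x,
    c ≠ 0 → (∀ e : ℕ, c * y ^ p ^ e ∈ Ideal.span ((fun z : W₂.presheaf.stalk x => z ^ p ^ e) ''
    (Ideal.span (Set.range s) : Set (W₂.presheaf.stalk x)))) → y ∈ Ideal.span (Set.range
    s))}.Finite) (hμ : ∃ μ : Scheme.{0} → ℕ, ∀ (W : Scheme.{0}) (g : W ⟶ Spec (.of k)) [IsSeparated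
    g] [LocallyOfFiniteType g] [QuasiCompact g] [IsIntegral W], (∀ w : W, IsDomain (W.presheaf.stalk
    w) ∧ ∀ d : ℕ, ringKrullDim (W.presheaf.stalk w) = d → ∀ s : Fin d → W.presheaf.stalk w,
    (Ideal.span (Set.range s)).radical.IsMaximal → RingTheory.Sequence.IsWeaklyRegular
    (W.presheaf.stalk w) (List.ofFn s) ∧ ∀ y : W.presheaf.stalk w, (∃ e : ℕ, y ^ p ^ e ∈ Ideal.span
    ((fun z : W.presheaf.stalk w => z ^ p ^ e) '' (Ideal.span (Set.range s) : Set (W.presheaf.stalk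
    w)))) → y ∈ Ideal.span (Set.range s)) → {w : W | ¬ (IsDomain (W.presheaf.stalk w) ∧ ∀ d : ℕ,
    ringKrullDim (W.presheaf.stalk w) = d → ∀ s : Fin d → W.presheaf.stalk w, (Ideal.span (Set.range
    s)).radical.IsMaximal → ∀ y c : W.presheaf.stalk w, c ≠ 0 → (∀ e : ℕ, c * y ^ p ^ e ∈ Ideal.span
    ((fun z : W.presheaf.stalk w => z ^ p ^ e) '' (Ideal.span (Set.range s) : Set (W.presheaf.stalk
    w)))) → y ∈ Ideal.span (Set.range s))}.Finite → {w : W | ¬ (IsDomain (W.presheaf.stalk w) ∧ ∀ d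
    : ℕ, ringKrullDim (W.presheaf.stalk w) = d → ∀ s : Fin d → W.presheaf.stalk w, (Ideal.span
    (Set.range s)).radical.IsMaximal → ∀ y c : W.presheaf.stalk w, c ≠ 0 → (∀ e : ℕ, c * y ^ p ^ e ∈
    Ideal.span ((fun z : W.presheaf.stalk w => z ^ p ^ e) '' (Ideal.span (Set.range s) : Set
    (W.presheaf.stalk w)))) → y ∈ Ideal.span (Set.range s))}.Nonempty → ∀ (W₁ : Scheme.{0}) (β : W₁
    ⟶ W), IsBlowup β (Scheme.IdealSheafData.vanishingIdeal (⟨closure {w : W | ¬ (IsDomain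
    (W.presheaf.stalk w) ∧ ∀ d : ℕ, ringKrullDim (W.presheaf.stalk w) = d → ∀ s : Fin d →
    W.presheaf.stalk w, (Ideal.span (Set.range s)).radical.IsMaximal → ∀ y c : W.presheaf.stalk w, c
    ≠ 0 → (∀ e : ℕ, c * y ^ p ^ e ∈ Ideal.span ((fun z : W.presheaf.stalk w => z ^ p ^ e) ''
    (Ideal.span (Set.range s) : Set (W.presheaf.stalk w)))) → y ∈ Ideal.span (Set.range s))},
    isClosed_closure⟩ : Closeds W)) → ∀ (W₂ : Scheme.{0}) (ν : W₂ ⟶ W₁) [IsIntegral W₂], (∀ x : W₂,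
    IsIntegrallyClosed (W₂.presheaf.stalk x)) → ∀ [IsFinite ν], IsBirational ν → (∀ x : W₂, IsDomain
    (W₂.presheaf.stalk x) ∧ ∀ d : ℕ, ringKrullDim (W₂.presheaf.stalk x) = d → ∀ s : Fin d →
    W₂.presheaf.stalk x, (Ideal.span (Set.range s)).radical.IsMaximal →
    RingTheory.Sequence.IsWeaklyRegular (W₂.presheaf.stalk x) (List.ofFn s) ∧ ∀ y :
    W₂.presheaf.stalk x, (∃ e : ℕ, y ^ p ^ e ∈ Ideal.span ((fun z : W₂.presheaf.stalk x => z ^ p ^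
    e) '' (Ideal.span (Set.range s) : Set (W₂.presheaf.stalk x)))) → y ∈ Ideal.span (Set.range s)) →
    {x : W₂ | ¬ (IsDomain (W₂.presheaf.stalk x) ∧ ∀ d : ℕ, ringKrullDim (W₂.presheaf.stalk x) = d →
    ∀ s : Fin d → W₂.presheaf.stalk x, (Ideal.span (Set.range s)).radical.IsMaximal → ∀ y c :
    W₂.presheaf.stalk x, c ≠ 0 → (∀ e : ℕ, c * y ^ p ^ e ∈ Ideal.span ((fun z : W₂.presheaf.stalk x
    => z ^ p ^ e) '' (Ideal.span (Set.range s) : Set (W₂.presheaf.stalk x)))) → y ∈ Ideal.span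
    (Set.range s))}.Finite → μ W₂ < μ W) (Y : Scheme.{0}) (g : Y ⟶ Spec (.of k)) [IsSeparated g]
    [LocallyOfFiniteType g] [QuasiCompact g] [IsIntegral Y] (h₂ : ∀ y : Y, IsDomain
    (Y.presheaf.stalk y) ∧ ∀ d : ℕ, ringKrullDim (Y.presheaf.stalk y) = d → ∀ s : Fin d →
    Y.presheaf.stalk y, (Ideal.span (Set.range s)).radical.IsMaximal →
    RingTheory.Sequence.IsWeaklyRegular (Y.presheaf.stalk y) (List.ofFn s) ∧ ∀ w : Y.presheaf.stalk
    y, (∃ e : ℕ, w ^ p ^ e ∈ Ideal.span ((fun z : Y.presheaf.stalk y => z ^ p ^ e) '' (Ideal.span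
    (Set.range s) : Set (Y.presheaf.stalk y)))) → w ∈ Ideal.span (Set.range s)) : ∃ (Y₂ :
    Scheme.{0}) (π : Y₂ ⟶ Y), IsProper π ∧ IsBirational π ∧ ∀ x : Y₂, IsDomain (Y₂.presheaf.stalk x)
    ∧ ∀ d : ℕ, ringKrullDim (Y₂.presheaf.stalk x) = d → ∀ s : Fin d → Y₂.presheaf.stalk x,
    (Ideal.span (Set.range s)).radical.IsMaximal → ∀ y c : Y₂.presheaf.stalk x, c ≠ 0 → (∀ e : ℕ, c
    * y ^ p ^ e ∈ Ideal.span ((fun z : Y₂.presheaf.stalk x => z ^ p ^ e) '' (Ideal.span (Set.range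
    s) : Set (Y₂.presheaf.stalk x)))) → y ∈ Ideal.span (Set.range s) := by
  sorry

/-! ## The composition: the crux BY NAME, sorry-free modulo the four stubs -/

/-- **Line `cartier-crystal-centres` closes the crux modulo its stubs.** The plain integral form of the
crux (`IntegralForm.fRationalModification_iff_integral`, landed p131587) is supplied by
`stub_towerAssembly` fed with the three engine stubs. -/
theorem FRationalModification_of : FRationalModification :=
  IntegralForm.fRationalModification_iff_integral.mpr fun p hp k _ _ Y g hsep hft hqc hY h₂ => by
    haveI : Fact p.Prime := ⟨hp⟩
    haveI := hsep; haveI := hft; haveI := hqc; haveI := hY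
    exact stub_towerAssembly p k
      (fun W g _ _ _ _ h => stub_isolateDefect p k W g h)
      (fun W g _ _ _ _ h hfin hne W₁ β hβ W₂ ν _ hN _ hν =>
        stub_pointStep_preserves p k W g h hfin hne W₁ β hβ W₂ ν hN hν)
      (stub_pointTower_measure p k) Y g h₂

end Summit.ResolutionOfSingularities.ResolutionOfSingularities.Cruxes.FRationalModification.Lines.CartierCrystalCentres

end
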